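import Literature.NumberTheory.LFunctions.KMVExactAFEAllOrdersProofs
import HarnessLib

/-!
# KMV 2000 (21)–(22) for TWO derivative orders `(i, j)`: the series side in real form (helper for crux K_A
# `PrimeLevelFamEdge.MomentsBeyondDiagonal`, stmt-Parity-20007, line «petersson_layers» v4)

The ∀`Q` satellites `stub_first`/`stub_identP`/`stub_diag` of K_A need the TWO-ORDER exact AFE
`Λ^{(i)}(f,½)Λ^{(j)}(f,½) = (1+(−1)^{i+j}) q̂ Σ_{n₁,n₂} λ_f(n₁)λ_f(n₂)(n₁n₂)^{−1/2} W_{ij}(q̂;n₁,n₂)` (deck 21a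
`…PeterssonLayersSplit` §1; lead report g2 §3(b): not KMV's printed one-order (22), hitherto untyped). Step 1 of
its kernel proof: the `(i, j)` version of the tree's `KMV2000.hasSum_logCutoffW_afe` (`KMVAfeLogSeries`, case
`i = j`) by the SAME argument (q-expansion opened twice, substitutions `x₁ = 2πn₁y`, `x₂ = 2πn₂v`, domination by
Rankin's bound with exponent `A = i + j + 3` and Hecke's bound `Σ ‖a_n‖n^{-3} < ∞`). Step 2 (the identity) is
`PrimeLevelFamEdgeMomentsBeyondDiagonalTwoOrderAFE.lean`. Proof only; nothing about Landau–Siegel zeros; K_A NOT proved.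
-/

noncomputable section

open scoped Real
open Complex Set MeasureTheory Filter CongruenceSubgroup UpperHalfPlane
open Literature.NumberTheory.EllipticCurves.ModularForms
open Literature.NumberTheory.LFunctions Literature.NumberTheory.LFunctions.KMV2000

namespace Summit.Parity.GeneralizedHardyLittlewood.Theorems.MomentsBeyondDiagonal.TwoOrderAFE

variable {N : ℕ} [NeZero N]

set_option maxHeartbeats 400000 in
/-- **The series side of KMV (21)–(22) at TWO orders `(i, j)`, in real form**: for every `f ∈ S₂(Γ₀(N))`,
`Σ_{(n₁,n₂)∈ℕ×ℕ} λ_f(n₁)λ_f(n₂)(n₁n₂)^{−1/2} W_{ij}(log q̂/n₁, log q̂/n₂; n₁n₂/q̂²)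
 = 4π² ∫_0^∞ f(iy)(log √N y)^i (∫_{v>1/(Ny)} f(iv)(log √N v)^j dv) dy` as a `HasSum`
(the tree's `KMV2000.hasSum_logCutoffW_afe` is the case `i = j`).
[cite: KowalskiMichelVanderKam2000, (21)–(22) p. 12] -/
theorem hasSum_logCutoffW_afe₂ (f : CuspForm (Gamma0 N) 2) (i j : ℕ) :
    HasSum (fun n : ℕ × ℕ ↦ GL2Family.heckeLambda f n.1 * GL2Family.heckeLambda f n.2 *
        ((((n.1 : ℝ) * n.2) ^ (-(1 / 2 : ℝ)) : ℝ) : ℂ) *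
        ((logCutoffW i j (Real.log (qhat N / n.1)) (Real.log (qhat N / n.2))
          ((n.1 : ℝ) * n.2 / qhat N ^ 2) : ℝ) : ℂ))
      (4 * (π : ℂ) ^ 2 *
        ∫ y in Ioi (0 : ℝ), (f (UpperHalfPlane.ofComplex (Complex.I * y)) *
            (((Real.log (Real.sqrt N * y)) ^ i : ℝ) : ℂ)) *
          ∫ v in Ioi (((N : ℝ) * y)⁻¹), f (UpperHalfPlane.ofComplex (Complex.I * v)) *
            (((Real.log (Real.sqrt N * v)) ^ j : ℝ) : ℂ)) := by
  have hN : (0 : ℝ) < N := by exact_mod_cast NeZero.pos N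
  have h0 : cuspCoeff f 0 = 0 := cuspCoeff_zero one_mem_strictPeriods_Gamma0 f
  have hq : 0 < qhat N := qhat_pos_of_neZero N
  set w₁ : ℝ → ℝ := fun v ↦ (Real.log (Real.sqrt N * v)) ^ i with hw₁
  set w₂ : ℝ → ℝ := fun v ↦ (Real.log (Real.sqrt N * v)) ^ j with hw₂
  set G₁ : ℝ → ℂ := fun v ↦ f (UpperHalfPlane.ofComplex (Complex.I * v)) * ((w₁ v : ℝ) : ℂ) with hG₁
  set G₂ : ℝ → ℂ := fun v ↦ f (UpperHalfPlane.ofComplex (Complex.I * v)) * ((w₂ v : ℝ) : ℂ) with hG₂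
  set E : ℕ → ℝ → ℝ := fun n x ↦ Real.exp (-x) * (Real.log (qhat N / n) + Real.log x) ^ j with hE
  set J : ℕ → ℝ → ℝ := fun n z ↦ ∫ x in Ioi z, E n x with hJ
  set A : ℕ → ℝ → ℂ := fun n y ↦ cuspCoeff f n * ((Real.exp (-(2 * Real.pi * n) * y) * w₁ y : ℝ) : ℂ) with hA
  set B : ℕ → ℝ → ℂ := fun n y ↦ cuspCoeff f n *
    ((∫ v in Ioi (((N : ℝ) * y)⁻¹), Real.exp (-(2 * Real.pi * n) * v) * w₂ v : ℝ) : ℂ) with hB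
  set T : ℕ × ℕ → ℝ → ℂ := fun p y ↦ A p.1 y * B p.2 y with hT
  have A_zero : A 0 = fun _ ↦ 0 := by funext y; simp [hA, h0]
  have B_zero : B 0 = fun _ ↦ 0 := by funext y; simp [hB, h0]
  have T_fst_zero : ∀ n₂ : ℕ, T (0, n₂) = fun _ ↦ 0 := by intro n₂; funext y; simp [hT, A_zero]
  have T_snd_zero : ∀ n₁ : ℕ, T (n₁, 0) = fun _ ↦ 0 := by intro n₁; funext y; simp [hT, B_zero]
  have hcN : ∀ {y : ℝ}, 0 < y → 0 < ((N : ℝ) * y)⁻¹ := fun hy ↦ by positivity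
  have B_eq : ∀ {n : ℕ}, n ≠ 0 → ∀ {y : ℝ}, 0 < y →
      B n y = cuspCoeff f n * (((2 * π * n)⁻¹ * J n (2 * π * n * ((N : ℝ) * y)⁻¹) : ℝ) : ℂ) := by
    intro n hn y hy
    simp only [hB, hJ, hE, hw₂]
    rw [integral_Ioi_exp_comp_logWeight hn (hcN hy) (fun u ↦ u ^ j)]
  have J_cont : ∀ {n : ℕ}, n ≠ 0 → ContinuousOn (fun y : ℝ ↦ J n (2 * π * n * ((N : ℝ) * y)⁻¹)) (Ioi 0) := by
    intro n hn y hy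
    have hy : (0 : ℝ) < y := hy
    have hc : 0 < qhat N / n := div_pos hq (by exact_mod_cast Nat.pos_of_ne_zero hn)
    have hz : 0 < 2 * π * n * ((N : ℝ) * y)⁻¹ := by
      have : (0 : ℝ) < n := by exact_mod_cast Nat.pos_of_ne_zero hn
      positivity
    have h1 : ContinuousAt (fun y : ℝ ↦ 2 * π * n * ((N : ℝ) * y)⁻¹) y :=
      ContinuousAt.mul continuousAt_const ((continuousAt_const.mul continuousAt_id).inv₀
        (mul_ne_zero hN.ne' hy.ne'))
    exact (ContinuousAt.comp (g := fun z : ℝ ↦ ∫ x in Ioi z, E n x)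
      (f := fun y : ℝ ↦ 2 * π * n * ((N : ℝ) * y)⁻¹) (continuousAt_tail hc j hz) h1).continuousWithinAt
  have w_cont : ContinuousOn w₁ (Ioi 0) := by
    have hs : (0 : ℝ) < Real.sqrt N := Real.sqrt_pos.mpr hN
    refine ContinuousOn.pow (Real.continuousOn_log.comp (by fun_prop) fun v hv ↦ ?_) i
    exact (mul_pos hs hv).ne'
  have T_cont : ∀ p : ℕ × ℕ, p.1 ≠ 0 → p.2 ≠ 0 → ContinuousOn (T p) (Ioi 0) := by
    rintro ⟨n₁, n₂⟩ hn₁ hn₂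
    have hA_cont : ContinuousOn (A n₁) (Ioi 0) := by
      refine continuousOn_const.mul (Complex.continuous_ofReal.comp_continuousOn ?_)
      exact ContinuousOn.mul (by fun_prop) w_cont
    have hB_cont : ContinuousOn (B n₂) (Ioi 0) := by
      have h : ContinuousOn (fun y : ℝ ↦ cuspCoeff f n₂ *
          (((2 * π * n₂)⁻¹ * J n₂ (2 * π * n₂ * ((N : ℝ) * y)⁻¹) : ℝ) : ℂ)) (Ioi 0) :=
        continuousOn_const.mul (Complex.continuous_ofReal.comp_continuousOn
          (continuousOn_const.mul (J_cont hn₂)))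
      exact h.congr fun y hy ↦ B_eq hn₂ hy
    exact hA_cont.mul hB_cont
  obtain ⟨K, hK⟩ : ∃ K : ℕ, K = i + j := ⟨_, rfl⟩
  set Aexp : ℝ := ((K + 3 : ℕ) : ℝ) with hAexp
  have hAnn : 0 ≤ Aexp := by positivity
  set M₁ : ℕ → ℝ := fun n ↦ ∫ x in Ioi (0 : ℝ), x ^ Aexp *
    (Real.exp (-x) * |Real.log (qhat N / n) + Real.log x| ^ i) with hM₁
  set M₂ : ℕ → ℝ := fun n ↦ ∫ x in Ioi (0 : ℝ), x ^ Aexp *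
    (Real.exp (-x) * |Real.log (qhat N / n) + Real.log x| ^ j) with hM₂
  have hM₂nn : ∀ n, 0 ≤ M₂ n := fun n ↦ setIntegral_nonneg measurableSet_Ioi fun x hx ↦ by
    have hx : (0 : ℝ) < x := hx; positivity
  set C₁ : ℝ := ∫ x in Ioi (0 : ℝ), x ^ Aexp * (Real.exp (-x) * (2 ^ i * (1 + |Real.log x| ^ i))) with hC₁
  set C₂ : ℝ := ∫ x in Ioi (0 : ℝ), x ^ Aexp * (Real.exp (-x) * (2 ^ j * (1 + |Real.log x| ^ j))) with hC₂
  have hMle₁ : ∀ n, M₁ n ≤ (1 + |Real.log (qhat N / n)|) ^ i * C₁ := fun n ↦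
    (integral_rpow_exp_abs_log_pow_le (Real.log (qhat N / n)) i hAnn).2
  have hMle₂ : ∀ n, M₂ n ≤ (1 + |Real.log (qhat N / n)|) ^ j * C₂ := fun n ↦
    (integral_rpow_exp_abs_log_pow_le (Real.log (qhat N / n)) j hAnn).2
  have hC₁nn : 0 ≤ C₁ := setIntegral_nonneg measurableSet_Ioi fun x hx ↦ by
    have hx : (0 : ℝ) < x := hx; positivity
  have hC₂nn : 0 ≤ C₂ := setIntegral_nonneg measurableSet_Ioi fun x hx ↦ by
    have hx : (0 : ℝ) < x := hx; positivity
  have harg : ∀ {n₁ n₂ : ℕ}, n₁ ≠ 0 → ∀ {x : ℝ}, 0 < x →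
      2 * π * n₂ * ((N : ℝ) * (x / (2 * π * n₁)))⁻¹ = ((n₁ : ℝ) * n₂ / qhat N ^ 2) / x := by
    intro n₁ n₂ hn₁ x hx
    have hn₁' : (n₁ : ℝ) ≠ 0 := by exact_mod_cast hn₁
    rw [← four_pi_sq_mul_div_eq]; field_simp; ring
  have integral_T : ∀ {n₁ n₂ : ℕ}, n₁ ≠ 0 → n₂ ≠ 0 →
      ∫ y in Ioi (0 : ℝ), T (n₁, n₂) y = cuspCoeff f n₁ * cuspCoeff f n₂ *
        (((2 * π * n₂)⁻¹ * (2 * π * n₁)⁻¹ *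
          logCutoffW i j (Real.log (qhat N / n₁)) (Real.log (qhat N / n₂)) ((n₁ : ℝ) * n₂ / qhat N ^ 2) : ℝ) : ℂ) := by
    intro n₁ n₂ hn₁ hn₂
    have hpt : ∀ y ∈ Ioi (0 : ℝ), T (n₁, n₂) y = cuspCoeff f n₁ * cuspCoeff f n₂ *
        (((2 * π * n₂)⁻¹ * (Real.exp (-(2 * Real.pi * n₁) * y) * w₁ y *
          J n₂ (2 * π * n₂ * ((N : ℝ) * y)⁻¹)) : ℝ) : ℂ) := by
      intro y hy
      have hy : (0 : ℝ) < y := hy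
      simp only [hT]; rw [B_eq hn₂ hy]; simp only [hA]; push_cast; ring
    rw [setIntegral_congr_fun measurableSet_Ioi hpt, integral_const_mul, integral_complex_ofReal,
      integral_const_mul]
    have hsub := integral_Ioi_exp_comp_logWeight_mul (N := N) hn₁ (fun u ↦ u ^ i)
      (fun y ↦ J n₂ (2 * π * n₂ * ((N : ℝ) * y)⁻¹))
    have hW : ∫ x in Ioi (0 : ℝ), Real.exp (-x) * (Real.log (qhat N / n₁) + Real.log x) ^ i *
        J n₂ (2 * π * n₂ * ((N : ℝ) * (x / (2 * π * n₁)))⁻¹) =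
        logCutoffW i j (Real.log (qhat N / n₁)) (Real.log (qhat N / n₂)) ((n₁ : ℝ) * n₂ / qhat N ^ 2) := by
      rw [logCutoffW]
      refine setIntegral_congr_fun measurableSet_Ioi fun x hx ↦ ?_
      simp only [hJ, hE]; rw [harg hn₁ hx]
    have hreal : ∫ y in Ioi (0 : ℝ), Real.exp (-(2 * Real.pi * n₁) * y) * w₁ y *
        J n₂ (2 * π * n₂ * ((N : ℝ) * y)⁻¹) =
        (2 * π * n₁)⁻¹ * logCutoffW i j (Real.log (qhat N / n₁)) (Real.log (qhat N / n₂))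
          ((n₁ : ℝ) * n₂ / qhat N ^ 2) := by
      simp only [hw₁]; rw [hsub, hW]
    rw [hreal]; push_cast; ring
  have norm_T : ∀ {n₁ n₂ : ℕ}, n₁ ≠ 0 → n₂ ≠ 0 → ∀ {y : ℝ}, 0 < y →
      ‖T (n₁, n₂) y‖ ≤ ‖cuspCoeff f n₁‖ * ‖cuspCoeff f n₂‖ * ((2 * π * n₂)⁻¹ * M₂ n₂ *
        (Real.exp (-(2 * Real.pi * n₁) * y) * |Real.log (Real.sqrt N * y)| ^ i *
          (2 * π * n₁ * y / ((n₁ : ℝ) * n₂ / qhat N ^ 2)) ^ Aexp)) := by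
    intro n₁ n₂ hn₁ hn₂ y hy
    have hn₁' : (0 : ℝ) < n₁ := by exact_mod_cast Nat.pos_of_ne_zero hn₁
    have hn₂' : (0 : ℝ) < n₂ := by exact_mod_cast Nat.pos_of_ne_zero hn₂
    have hy₀ : 0 < (n₁ : ℝ) * n₂ / qhat N ^ 2 := by positivity
    have hx₁ : 0 < 2 * π * n₁ * y := by positivity
    have hinner : |J n₂ (2 * π * n₂ * ((N : ℝ) * y)⁻¹)| ≤
        (2 * π * n₁ * y / ((n₁ : ℝ) * n₂ / qhat N ^ 2)) ^ Aexp * M₂ n₂ := by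
      have heq : 2 * π * n₂ * ((N : ℝ) * y)⁻¹ = ((n₁ : ℝ) * n₂ / qhat N ^ 2) / (2 * π * n₁ * y) := by
        have h := harg (n₂ := n₂) hn₁ hx₁
        rw [← h]; congr 2; field_simp
      rw [heq]; simp only [hJ, hE]
      calc |∫ x in Ioi (((n₁ : ℝ) * n₂ / qhat N ^ 2) / (2 * π * n₁ * y)),
              Real.exp (-x) * (Real.log (qhat N / n₂) + Real.log x) ^ j|
          ≤ ∫ x in Ioi (((n₁ : ℝ) * n₂ / qhat N ^ 2) / (2 * π * n₁ * y)),
              |Real.exp (-x) * (Real.log (qhat N / n₂) + Real.log x) ^ j| := by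
            rw [← Real.norm_eq_abs]
            exact (norm_integral_le_integral_norm _).trans (le_of_eq rfl)
        _ = ∫ x in Ioi (((n₁ : ℝ) * n₂ / qhat N ^ 2) / (2 * π * n₁ * y)),
              Real.exp (-x) * |Real.log (qhat N / n₂) + Real.log x| ^ j := by
            refine setIntegral_congr_fun measurableSet_Ioi fun x _ ↦ ?_
            rw [abs_mul, abs_of_pos (Real.exp_pos _), abs_pow]
        _ ≤ _ := integral_abs_inner_tail_le (Real.log (qhat N / n₂)) j hAnn hy₀ hx₁
    simp only [hT, hA]
    rw [B_eq hn₂ hy, norm_mul, norm_mul, norm_mul, Complex.norm_real, Complex.norm_real,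
      Real.norm_eq_abs, Real.norm_eq_abs, abs_mul, abs_mul, abs_of_pos (Real.exp_pos _),
      abs_of_pos (by positivity : (0 : ℝ) < (2 * π * n₂)⁻¹)]
    simp only [hw₁, abs_pow]
    have e1 : 0 ≤ Real.exp (-(2 * Real.pi * n₁) * y) * |Real.log (Real.sqrt N * y)| ^ i := by positivity
    calc ‖cuspCoeff f n₁‖ * (Real.exp (-(2 * Real.pi * n₁) * y) * |Real.log (Real.sqrt N * y)| ^ i) *
          (‖cuspCoeff f n₂‖ * ((2 * π * n₂)⁻¹ * |J n₂ (2 * π * n₂ * ((N : ℝ) * y)⁻¹)|))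
        ≤ ‖cuspCoeff f n₁‖ * (Real.exp (-(2 * Real.pi * n₁) * y) * |Real.log (Real.sqrt N * y)| ^ i) *
          (‖cuspCoeff f n₂‖ * ((2 * π * n₂)⁻¹ *
            ((2 * π * n₁ * y / ((n₁ : ℝ) * n₂ / qhat N ^ 2)) ^ Aexp * M₂ n₂))) := by gcongr
      _ = _ := by ring
  have integral_dom : ∀ {n₁ n₂ : ℕ}, n₁ ≠ 0 → n₂ ≠ 0 →
      IntegrableOn (fun y : ℝ ↦ Real.exp (-(2 * Real.pi * n₁) * y) * |Real.log (Real.sqrt N * y)| ^ i *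
          (2 * π * n₁ * y / ((n₁ : ℝ) * n₂ / qhat N ^ 2)) ^ Aexp) (Ioi 0) ∧
      ∫ y in Ioi (0 : ℝ), Real.exp (-(2 * Real.pi * n₁) * y) * |Real.log (Real.sqrt N * y)| ^ i *
          (2 * π * n₁ * y / ((n₁ : ℝ) * n₂ / qhat N ^ 2)) ^ Aexp =
        (2 * π * n₁)⁻¹ * ((((n₁ : ℝ) * n₂ / qhat N ^ 2) ^ Aexp)⁻¹ * M₁ n₁) := by
    intro n₁ n₂ hn₁ hn₂
    have hn₁' : (0 : ℝ) < n₁ := by exact_mod_cast Nat.pos_of_ne_zero hn₁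
    have hn₂' : (0 : ℝ) < n₂ := by exact_mod_cast Nat.pos_of_ne_zero hn₂
    have hy₀ : 0 < (n₁ : ℝ) * n₂ / qhat N ^ 2 := by positivity
    set y₀ : ℝ := (n₁ : ℝ) * n₂ / qhat N ^ 2 with hy₀_def
    have hb : 0 < 2 * π * (n₁ : ℝ) := by positivity
    obtain ⟨hgint, -⟩ := integral_rpow_exp_abs_log_pow_le (Real.log (qhat N / n₁)) i hAnn
    have hg : IntegrableOn (fun x : ℝ ↦ Real.exp (-x) * |Real.log (qhat N / n₁) + Real.log x| ^ i *
        (x / y₀) ^ Aexp) (Ioi 0) := by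
      refine IntegrableOn.congr_fun (hgint.const_mul ((y₀ ^ Aexp)⁻¹)) (fun x hx ↦ ?_) measurableSet_Ioi
      have hx : (0 : ℝ) < x := hx; rw [Real.div_rpow hx.le hy₀.le]; ring
    have hpt : ∀ y ∈ Ioi (0 : ℝ), Real.exp (-(2 * Real.pi * n₁) * y) * |Real.log (Real.sqrt N * y)| ^ i *
        (2 * π * n₁ * y / y₀) ^ Aexp =
        (fun x : ℝ ↦ Real.exp (-x) * |Real.log (qhat N / n₁) + Real.log x| ^ i * (x / y₀) ^ Aexp)
          (2 * π * n₁ * y) := by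
      intro y hy; have hy : (0 : ℝ) < y := hy; simp only; rw [log_qhat_div_add_log hn₁ hy]; ring_nf
    constructor
    · have h2 := (integrableOn_Ioi_comp_mul_left_iff (fun x : ℝ ↦ Real.exp (-x) *
        |Real.log (qhat N / n₁) + Real.log x| ^ i * (x / y₀) ^ Aexp) 0 hb).mpr (by rw [mul_zero]; exact hg)
      exact IntegrableOn.congr_fun h2 (fun y hy ↦ (hpt y hy).symm) measurableSet_Ioi
    · rw [integral_Ioi_exp_comp_logWeight_mul (N := N) hn₁ (fun u ↦ |u| ^ i) (fun y ↦ (2 * π * n₁ * y / y₀) ^ Aexp)]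
      congr 1; simp only [hM₁]; rw [← integral_const_mul]
      refine setIntegral_congr_fun measurableSet_Ioi fun x hx ↦ ?_
      have hx : (0 : ℝ) < x := hx
      have hxx : 2 * π * (n₁ : ℝ) * (x / (2 * π * n₁)) = x := by field_simp
      rw [hxx, Real.div_rpow hx.le hy₀.le]; ring
  have integrableOn_T : ∀ p : ℕ × ℕ, IntegrableOn (T p) (Ioi 0) := by
    rintro ⟨n₁, n₂⟩
    rcases Nat.eq_zero_or_pos n₁ with rfl | h₁
    · rw [T_fst_zero]; exact integrableOn_zero
    rcases Nat.eq_zero_or_pos n₂ with rfl | h₂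
    · rw [T_snd_zero]; exact integrableOn_zero
    obtain ⟨hdom, -⟩ := integral_dom h₁.ne' h₂.ne'
    refine Integrable.mono' (hdom.const_mul (‖cuspCoeff f n₁‖ * ‖cuspCoeff f n₂‖ * ((2 * π * n₂)⁻¹ * M₂ n₂)))
      ((T_cont (n₁, n₂) h₁.ne' h₂.ne').aestronglyMeasurable measurableSet_Ioi) ?_
    refine (ae_restrict_iff' measurableSet_Ioi).mpr (ae_of_all _ fun y hy ↦ ?_)
    have h := norm_T h₁.ne' h₂.ne' (y := y) hy
    exact h.trans_eq (by ring)
  have norm_integral_T : ∀ {n₁ n₂ : ℕ}, n₁ ≠ 0 → n₂ ≠ 0 →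
      ∫ y in Ioi (0 : ℝ), ‖T (n₁, n₂) y‖ ≤ ‖cuspCoeff f n₁‖ * ‖cuspCoeff f n₂‖ *
        ((2 * π * n₂)⁻¹ * (2 * π * n₁)⁻¹ * ((((n₁ : ℝ) * n₂ / qhat N ^ 2) ^ Aexp)⁻¹ * (M₁ n₁ * M₂ n₂))) := by
    intro n₁ n₂ hn₁ hn₂
    obtain ⟨hdom, hval⟩ := integral_dom hn₁ hn₂
    calc ∫ y in Ioi (0 : ℝ), ‖T (n₁, n₂) y‖
        ≤ ∫ y in Ioi (0 : ℝ), ‖cuspCoeff f n₁‖ * ‖cuspCoeff f n₂‖ * ((2 * π * n₂)⁻¹ * M₂ n₂) *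
            (Real.exp (-(2 * Real.pi * n₁) * y) * |Real.log (Real.sqrt N * y)| ^ i *
              (2 * π * n₁ * y / ((n₁ : ℝ) * n₂ / qhat N ^ 2)) ^ Aexp) := by
          refine integral_mono_of_nonneg (ae_of_all _ fun y ↦ norm_nonneg _) (hdom.const_mul _) ?_
          exact (ae_restrict_iff' measurableSet_Ioi).mpr
            (ae_of_all _ fun y hy ↦ (norm_T hn₁ hn₂ hy).trans_eq (by ring))
      _ = ‖cuspCoeff f n₁‖ * ‖cuspCoeff f n₂‖ * ((2 * π * n₂)⁻¹ * M₂ n₂) *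
            ∫ y in Ioi (0 : ℝ), Real.exp (-(2 * Real.pi * n₁) * y) * |Real.log (Real.sqrt N * y)| ^ i *
              (2 * π * n₁ * y / ((n₁ : ℝ) * n₂ / qhat N ^ 2)) ^ Aexp := integral_const_mul _ _
      _ = _ := by rw [hval]; ring
  set L : ℝ := 1 + |Real.log (qhat N)| with hL
  have hL1 : 1 ≤ L := by have := abs_nonneg (Real.log (qhat N)); linarith
  have hlogle : ∀ {n : ℕ}, n ≠ 0 → 1 + |Real.log (qhat N / n)| ≤ L * n := by
    intro n hn
    have hn' : (1 : ℝ) ≤ n := by exact_mod_cast Nat.one_le_iff_ne_zero.mpr hn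
    have hn0 : (0 : ℝ) < n := by linarith
    have hlogn : 0 ≤ Real.log n := Real.log_nonneg hn'
    have hlogn' : Real.log n ≤ n - 1 := Real.log_le_sub_one_of_pos hn0
    rw [Real.log_div hq.ne' hn0.ne']
    calc 1 + |Real.log (qhat N) - Real.log n| ≤ 1 + (|Real.log (qhat N)| + Real.log n) := by
          have := abs_sub (Real.log (qhat N)) (Real.log n); rw [abs_of_nonneg hlogn] at this; linarith
      _ ≤ (1 + |Real.log (qhat N)|) * (1 + Real.log n) := by
          nlinarith [abs_nonneg (Real.log (qhat N))]
      _ ≤ L * n := by rw [hL]; gcongr; linarith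
  have hLn : ∀ {n : ℕ}, n ≠ 0 → 1 ≤ L * n := fun {n} hn ↦ by
    have hn' : (1 : ℝ) ≤ n := by exact_mod_cast Nat.one_le_iff_ne_zero.mpr hn
    nlinarith
  have hMle₁' : ∀ {n : ℕ}, n ≠ 0 → M₁ n ≤ (L * n) ^ K * C₁ := fun {n} hn ↦
    (hMle₁ n).trans (mul_le_mul_of_nonneg_right ((pow_le_pow_left₀ (by positivity) (hlogle hn) i).trans
      (pow_le_pow_right₀ (hLn hn) (by omega))) hC₁nn)
  have hMle₂' : ∀ {n : ℕ}, n ≠ 0 → M₂ n ≤ (L * n) ^ K * C₂ := fun {n} hn ↦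
    (hMle₂ n).trans (mul_le_mul_of_nonneg_right ((pow_le_pow_left₀ (by positivity) (hlogle hn) j).trans
      (pow_le_pow_right₀ (hLn hn) (by omega))) hC₂nn)
  have summable_norm_T : Summable fun p : ℕ × ℕ ↦ ∫ y in Ioi (0 : ℝ), ‖T p y‖ := by
    set b : ℕ → ℝ := fun n ↦ ‖LSeries.term (cuspCoeff f) 3 n‖ with hb
    have hbs : Summable b := (LSeriesSummable_cuspCoeff_gamma0 f (s := 3) (by norm_num)).norm
    have hb_eq : ∀ n : ℕ, n ≠ 0 → b n = ‖cuspCoeff f n‖ / (n : ℝ) ^ 3 := by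
      intro n hn; simp only [hb, LSeries.norm_term_eq, hn, if_false]; norm_num
    have hb0 : b 0 = 0 := by simp [hb, LSeries.norm_term_eq]
    have hprod : Summable fun p : ℕ × ℕ ↦ b p.1 * b p.2 :=
      summable_mul_of_summable_norm (f := b) (g := b)
        (hbs.norm.congr fun n ↦ by simp) (hbs.norm.congr fun n ↦ by simp)
    set Kc : ℝ := (2 * π)⁻¹ * (2 * π)⁻¹ * ((qhat N ^ 2) ^ Aexp * (C₁ * C₂ * (L ^ K * L ^ K))) with hKc
    refine (hprod.mul_left Kc).of_nonneg_of_le (fun p ↦ integral_nonneg fun y ↦ norm_nonneg _) fun p ↦ ?_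
    obtain ⟨n₁, n₂⟩ := p
    rcases Nat.eq_zero_or_pos n₁ with rfl | h₁
    · simp only [T_fst_zero, norm_zero, integral_zero, hb0, zero_mul, mul_zero]; exact le_refl _
    rcases Nat.eq_zero_or_pos n₂ with rfl | h₂
    · simp only [T_snd_zero, norm_zero, integral_zero, hb0, mul_zero]; exact le_refl _
    have hn₁ : (0 : ℝ) < n₁ := by exact_mod_cast h₁
    have hn₂ : (0 : ℝ) < n₂ := by exact_mod_cast h₂
    have hn₁1 : (1 : ℝ) ≤ n₁ := by exact_mod_cast h₁
    have hn₂1 : (1 : ℝ) ≤ n₂ := by exact_mod_cast h₂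
    simp only
    rw [hb_eq n₁ h₁.ne', hb_eq n₂ h₂.ne']
    refine (norm_integral_T h₁.ne' h₂.ne').trans ?_
    have hy₀A : (((n₁ : ℝ) * n₂ / qhat N ^ 2) ^ Aexp)⁻¹ = (qhat N ^ 2) ^ Aexp / ((n₁ : ℝ) * n₂) ^ (K + 3) := by
      rw [Real.div_rpow (by positivity) (by positivity), inv_div, hAexp, Real.rpow_natCast ((n₁ : ℝ) * n₂)]
    rw [hy₀A]
    have hM₁ := hMle₁' h₁.ne'
    have hM₂ := hMle₂' h₂.ne'
    have hMM : M₁ n₁ * M₂ n₂ ≤ (L * n₁) ^ K * C₁ * ((L * n₂) ^ K * C₂) :=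
      mul_le_mul hM₁ hM₂ (hM₂nn _) (by positivity)
    have hqA : 0 ≤ (qhat N ^ 2) ^ Aexp := by positivity
    calc ‖cuspCoeff f n₁‖ * ‖cuspCoeff f n₂‖ * ((2 * π * n₂)⁻¹ * (2 * π * n₁)⁻¹ *
          ((qhat N ^ 2) ^ Aexp / ((n₁ : ℝ) * n₂) ^ (K + 3) * (M₁ n₁ * M₂ n₂)))
        ≤ ‖cuspCoeff f n₁‖ * ‖cuspCoeff f n₂‖ * ((2 * π * n₂)⁻¹ * (2 * π * n₁)⁻¹ *
          ((qhat N ^ 2) ^ Aexp / ((n₁ : ℝ) * n₂) ^ (K + 3) * ((L * n₁) ^ K * C₁ * ((L * n₂) ^ K * C₂)))) := by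
          gcongr
      _ = Kc * (‖cuspCoeff f n₁‖ / (n₁ : ℝ) ^ 3 * (‖cuspCoeff f n₂‖ / (n₂ : ℝ) ^ 3)) *
          ((n₁ : ℝ)⁻¹ * (n₂ : ℝ)⁻¹) := by
          rw [hKc]; field_simp; ring
      _ ≤ Kc * (‖cuspCoeff f n₁‖ / (n₁ : ℝ) ^ 3 * (‖cuspCoeff f n₂‖ / (n₂ : ℝ) ^ 3)) * 1 := by
          have hK0 : 0 ≤ Kc * (‖cuspCoeff f n₁‖ / (n₁ : ℝ) ^ 3 * (‖cuspCoeff f n₂‖ / (n₂ : ℝ) ^ 3)) := by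
            positivity
          exact mul_le_mul_of_nonneg_left (by rw [← mul_inv]; exact inv_le_one_of_one_le₀ (by nlinarith)) hK0
      _ = _ := by ring
  have hasSum_T : ∀ {y : ℝ}, 0 < y → HasSum (fun p : ℕ × ℕ ↦ T p y)
      (G₁ y * ∫ v in Ioi (((N : ℝ) * y)⁻¹), G₂ v) := by
    intro y hy
    have hA' := hasSum_imagAxis_logWeight f i hy
    have hB' := hasSum_integral_Ioi_imagAxis_logWeight f j (hcN hy)
    have hAn := summable_norm_iff.mpr hA'.summable
    have hBn := summable_norm_iff.mpr hB'.summable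
    have hfun : (fun p : ℕ × ℕ ↦ T p y) = fun p : ℕ × ℕ ↦
        (cuspCoeff f p.1 * (Real.exp (-(2 * Real.pi * p.1) * y) : ℝ) *
          (((Real.log (Real.sqrt N * y)) ^ i : ℝ) : ℂ)) *
        (cuspCoeff f p.2 * ((∫ v in Ioi (((N : ℝ) * y)⁻¹), Real.exp (-(2 * Real.pi * p.2) * v) *
          (Real.log (Real.sqrt N * v)) ^ j : ℝ) : ℂ)) := by
      funext p; simp only [hT, hA, hB, hw₁, hw₂]; push_cast; ring
    have hval : G₁ y * ∫ v in Ioi (((N : ℝ) * y)⁻¹), G₂ v =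
        (f (UpperHalfPlane.ofComplex (Complex.I * y)) * (((Real.log (Real.sqrt N * y)) ^ i : ℝ) : ℂ)) *
          ∫ v in Ioi (((N : ℝ) * y)⁻¹), f (UpperHalfPlane.ofComplex (Complex.I * v)) *
            (((Real.log (Real.sqrt N * v)) ^ j : ℝ) : ℂ) := by
      simp only [hG₁, hG₂, hw₁, hw₂]
    have hprod := summable_mul_of_summable_norm
      (f := fun n : ℕ ↦ cuspCoeff f n * (Real.exp (-(2 * Real.pi * n) * y) : ℝ) *
        (((Real.log (Real.sqrt N * y)) ^ i : ℝ) : ℂ))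
      (g := fun n : ℕ ↦ cuspCoeff f n * ((∫ v in Ioi (((N : ℝ) * y)⁻¹), Real.exp (-(2 * Real.pi * n) * v) *
        (Real.log (Real.sqrt N * v)) ^ j : ℝ) : ℂ)) hAn hBn
    have h := hA'.mul hB' hprod; rw [hfun, hval]; exact h
  have hmain := hasSum_integral_of_summable_integral_norm (μ := volume.restrict (Ioi (0 : ℝ)))
    (F := fun p y ↦ T p y) (fun p ↦ integrableOn_T p) summable_norm_T
  have heq : ∫ y in Ioi (0 : ℝ), (∑' p : ℕ × ℕ, T p y) =
      ∫ y in Ioi (0 : ℝ), G₁ y * ∫ v in Ioi (((N : ℝ) * y)⁻¹), G₂ v :=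
    setIntegral_congr_fun measurableSet_Ioi fun y hy ↦ (hasSum_T hy).tsum_eq
  rw [heq] at hmain
  have hterm : ∀ p : ℕ × ℕ, GL2Family.heckeLambda f p.1 * GL2Family.heckeLambda f p.2 *
        ((((p.1 : ℝ) * p.2) ^ (-(1 / 2 : ℝ)) : ℝ) : ℂ) *
        ((logCutoffW i j (Real.log (qhat N / p.1)) (Real.log (qhat N / p.2))
          ((p.1 : ℝ) * p.2 / qhat N ^ 2) : ℝ) : ℂ) =
      4 * (π : ℂ) ^ 2 * ∫ y in Ioi (0 : ℝ), T p y := by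
    rintro ⟨n₁, n₂⟩
    rcases Nat.eq_zero_or_pos n₁ with rfl | h₁
    · simp [T_fst_zero, heckeLambda_zero]
    rcases Nat.eq_zero_or_pos n₂ with rfl | h₂
    · simp [T_snd_zero, heckeLambda_zero]
    have hn₁ : (0 : ℝ) < n₁ := by exact_mod_cast h₁
    have hn₂ : (0 : ℝ) < n₂ := by exact_mod_cast h₂
    simp only
    rw [integral_T h₁.ne' h₂.ne', Bettin2017.heckeLambda_weight_two, Bettin2017.heckeLambda_weight_two]
    have hpow : (n₁ : ℝ) ^ (-(1 / 2 : ℝ)) * (n₂ : ℝ) ^ (-(1 / 2 : ℝ)) * ((n₁ : ℝ) * n₂) ^ (-(1 / 2 : ℝ)) =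
        1 / ((n₁ : ℝ) * n₂) := by
      rw [← Real.mul_rpow hn₁.le hn₂.le, ← Real.rpow_add (mul_pos hn₁ hn₂),
        show (-(1 / 2 : ℝ)) + -(1 / 2) = -1 by norm_num, Real.rpow_neg_one, one_div]
    have hpowC : (((n₁ : ℝ) ^ (-(1 / 2 : ℝ)) : ℝ) : ℂ) * (((n₂ : ℝ) ^ (-(1 / 2 : ℝ)) : ℝ) : ℂ) *
        ((((n₁ : ℝ) * n₂) ^ (-(1 / 2 : ℝ)) : ℝ) : ℂ) = 1 / ((n₁ : ℂ) * n₂) := by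
      have h := congrArg (fun x : ℝ ↦ (x : ℂ)) hpow; push_cast at h; exact h
    have hπ : (π : ℂ) ≠ 0 := by exact_mod_cast Real.pi_pos.ne'
    have hn₁' : (n₁ : ℂ) ≠ 0 := by exact_mod_cast h₁.ne'
    have hn₂' : (n₂ : ℂ) ≠ 0 := by exact_mod_cast h₂.ne'
    set W : ℝ := logCutoffW i j (Real.log (qhat N / n₁)) (Real.log (qhat N / n₂)) ((n₁ : ℝ) * n₂ / qhat N ^ 2)
      with hW
    push_cast
    calc cuspCoeff f n₁ * (((n₁ : ℝ) ^ (-(1 / 2 : ℝ)) : ℝ) : ℂ) *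
          (cuspCoeff f n₂ * (((n₂ : ℝ) ^ (-(1 / 2 : ℝ)) : ℝ) : ℂ)) *
          ((((n₁ : ℝ) * n₂) ^ (-(1 / 2 : ℝ)) : ℝ) : ℂ) * (W : ℂ)
        = cuspCoeff f n₁ * cuspCoeff f n₂ * (W : ℂ) *
          ((((n₁ : ℝ) ^ (-(1 / 2 : ℝ)) : ℝ) : ℂ) * (((n₂ : ℝ) ^ (-(1 / 2 : ℝ)) : ℝ) : ℂ) *
            ((((n₁ : ℝ) * n₂) ^ (-(1 / 2 : ℝ)) : ℝ) : ℂ)) := by ring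
      _ = cuspCoeff f n₁ * cuspCoeff f n₂ * (W : ℂ) * (1 / ((n₁ : ℂ) * n₂)) := by rw [hpowC]
      _ = _ := by field_simp; norm_num
  have hfun : (fun p : ℕ × ℕ ↦ GL2Family.heckeLambda f p.1 * GL2Family.heckeLambda f p.2 *
        ((((p.1 : ℝ) * p.2) ^ (-(1 / 2 : ℝ)) : ℝ) : ℂ) *
        ((logCutoffW i j (Real.log (qhat N / p.1)) (Real.log (qhat N / p.2))
          ((p.1 : ℝ) * p.2 / qhat N ^ 2) : ℝ) : ℂ)) =
      fun p ↦ 4 * (π : ℂ) ^ 2 * ∫ y in Ioi (0 : ℝ), T p y := funext hterm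
  rw [hfun]; simp only [hG₁, hG₂, hw₁, hw₂] at hmain; exact hmain.mul_left _

end Summit.Parity.GeneralizedHardyLittlewood.Theorems.MomentsBeyondDiagonal.TwoOrderAFE

end
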